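import Literature.AnabelianGeometry.SemiGraphs.CoveringCellsGaloisAction
import Literature.AnabelianGeometry.Anabelioids.GaloisObjectsOfOpenNormal
import Literature.AnabelianGeometry.Anabelioids.Pi1RangeOrbitCriterion
import Mathlib.Topology.Algebra.ClopenNhdofOne
import HarnessLib

/-!
# PORT PRODUCTION (d), one side: an ESSENTIAL side of an edge-cell acquires a double incidence at some
# Galois level ([SemiAnbd] Def. 2.2 (i) p. 23, Rem. 2.2.1 p. 24, proof of Cor. 2.7 (i) p. 30)

Mochizuki, *Semi-graphs of anabelioids*, Publ. RIMS **42** (2006), §2: Def. 2.2 (i) p. 23 (cells of the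
covering semi-graph `𝔾_A` = connected components), Rem. 2.2.1 p. 24 (decomposition groups = stabilisers),
proof of Cor. 2.7 (i) p. 30 ("[as one verifies immediately] `ℋ′` injects into `𝒢′` as a subgraph")
[cite: MochizukiSemiAnbd2006, Cor. 2.7(i) p.30].  PROOF-ONLY (abc-iut cell, layer L3; FACT-LIST row F-1487,
CLASS route, brick R6a PORT PRODUCTION (d), file D1; seat abc-iut-f-161 gen 12; L3-lead ε50).  No definition,
no instance, no named fact.

Frame of `LevelEdgesOfObject` (abc-iut-L6-t18 / L3-t12): a vertex `v`, a branch `b ∋ v` of `e = e(b)`,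
basepoints `F` of `𝒢_v` and `F_e` of `𝒢_e`, a transport `α : b^* ⋙ F_e ≅ F`; `Π = Aut(ρ_v ⋙ F)`, the image
`D_b = (Π_b^{F_e,α}).map (Π_v → Π)` of the edge group.  A point `a₀ ∈ F(A_v)` LIES OVER the edge-cell
`(e, Q)` of `𝔾_A` (on the `b`-side) when its level edge is `Q`; the side is ESSENTIAL at `a₀` when some
element of `Π_v` fixes `a₀` but does not map into `D_b` (the vertex stabiliser of `a₀` is not inside the
edge group — the side is NOT HAIR).

* `exists_isGalois_doubleIncidence_of_essential` — **ONE-SIDED DOUBLE INCIDENCE**: if the `b`-side of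
  `(e, Q)` is essential at `a₀`, some GALOIS `Y → A` carries two DISTINCT `b`-branch-cells of `𝔾_Y` with
  ONE abutment, both over `(e, Q)` (the half of the input of `port_of_isGalois_of_doubleIncidence`).

Not here: the lift along covers (D2), the two-sided assembly (D3), hair (R7).  CLASS route only; nothing
here takes a side on [IUTchIII] Cor. 3.12.
-/

namespace Literature.AnabelianGeometry.SemiGraphs.SemiGraphOfAnabelioids.BObj

open CategoryTheory CategoryTheory.Limits CategoryTheory.PreGaloisCategory
open Literature.AnabelianGeometry.Anabelioids
open scoped Pointwise

universe v₁ u₁ u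

set_option backward.isDefEq.respectTransparency false -- `π₀Obj` coercions, as in `ComponentsReadBack.lean`

variable {𝒢 : SemiGraphOfAnabelioids.{v₁, u₁, u}}

/-- **The image of the edge group is closed in `Π`** (continuous image of the compact `Π_e = Aut F_e`).
[cite: MochizukiSemiAnbd2006, Rem. 2.2.1 p.24] -/
theorem isClosed_map_piVToPi_branchSubgroup {v : 𝒢.graph.Vertex} (F : 𝒢.V v ⥤ FintypeCat.{v₁})
    [FiberFunctor F] (b : 𝒢.graph.Branch) (h : 𝒢.graph.abuts b = some v)
    (Fe : 𝒢.E (𝒢.graph.edgeOf b) ⥤ FintypeCat.{v₁}) [FiberFunctor Fe]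
    (α : (𝒢.pull b v h).pullback ⋙ Fe ≅ F) :
    IsClosed (((𝒢.branchSubgroup F b h Fe α).map (𝒢.piVToPi v F) : Subgroup (𝒢.Pi v F)) :
      Set (𝒢.Pi v F)) := by
  rw [map_piVToPi_branchSubgroup_eq_range, MonoidHom.coe_range]
  refine (isCompact_range ((continuous_autMulEquivOfIso' _).comp ?_)).isClosed
  exact (continuous_pi1Map' (𝒢.ρ v) _).comp (continuous_pi1Map' (𝒢.pull b v h).pullback Fe)

/-- **ONE-SIDED DOUBLE INCIDENCE** ([SemiAnbd] proof of Cor. 2.7 (i) p. 30 read at a Galois level).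
In the frame `(v, b, F, F_e, α)`, let `a₀ ∈ F(A_v)` lie over the edge-cell `(e, Q)` on the `b`-side and
let the `b`-side be ESSENTIAL at `a₀`: some `u ∈ Π_v` fixes `a₀` while its image in `Π` is not in the
edge group `D_b`.  Then there are a Galois object `Y` of `B(𝒢)`, a morphism `g : Y → A`, and two DISTINCT
branch-cells `β ≠ β′` of `𝔾_Y` over `b`, with the SAME abutment, both lying over `(e, Q)` along `g`.
(`D_b` is closed and the stabiliser of `a₀` open, so an open normal `N ≤ Stab(a₀)` has `u ∉ D_b · N`;
take `Y` Galois with a point `y₀` of stabiliser `N` and `g : y₀ ↦ a₀`; the level edges of `y₀` and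
`u · y₀` are distinct — they differ by `u ∉ D_b · N` — and have the common end "the level vertex of
`y₀`", `u` being in the vertex group.) [cite: MochizukiSemiAnbd2006, Cor. 2.7(i) p.30] -/
theorem exists_isGalois_doubleIncidence_of_essential [GaloisCategory 𝒢.BObj] (A : 𝒢.BObj)
    {v : 𝒢.graph.Vertex} (F : 𝒢.V v ⥤ FintypeCat.{v₁}) [FiberFunctor F] [FiberFunctor (𝒢.ρ v ⋙ F)]
    (b : 𝒢.graph.Branch) (h : 𝒢.graph.abuts b = some v)
    (Fe : 𝒢.E (𝒢.graph.edgeOf b) ⥤ FintypeCat.{v₁}) [FiberFunctor Fe]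
    (α : (𝒢.pull b v h).pullback ⋙ Fe ≅ F) (Q : π₀Obj (A.T (𝒢.graph.edgeOf b)))
    (a₀ : F.obj (A.S v)) (ha₀ : Fe.map (A.ψ b v h).hom (α.inv.app (A.S v) a₀) ∈ Set.range (Fe.map Q.1.arrow))
    (hess : ∃ u : 𝒢.PiV v F, u • a₀ = a₀ ∧
      𝒢.piVToPi v F u ∉ (𝒢.branchSubgroup F b h Fe α).map (𝒢.piVToPi v F)) :
    ∃ (Y : 𝒢.BObj) (_ : IsGalois Y) (g : Y ⟶ A) (β β' : Y.fibreData.total.Branch),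
      Y.fibreData.proj.branchMap β = b ∧ β' ≠ β ∧ (Y.fibreData.total.abuts β).isSome ∧
      Y.fibreData.total.abuts β' = Y.fibreData.total.abuts β ∧
      (∀ γ ∈ [β, β'], (⟨𝒢.graph.edgeOf (Y.fibreData.proj.branchMap γ),
          componentUnder (g.fT (𝒢.graph.edgeOf (Y.fibreData.proj.branchMap γ))) (Y.brComp γ)⟩ :
        Σ e, π₀Obj (A.T e)) = ⟨𝒢.graph.edgeOf b, Q⟩) := by
  classical
  obtain ⟨u, hua, huD⟩ := hess
  -- notation: `Π`-coordinates
  let a : (𝒢.ρ v ⋙ F).obj A := a₀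
  let ub : 𝒢.Pi v F := 𝒢.piVToPi v F u
  let Db : Subgroup (𝒢.Pi v F) := (𝒢.branchSubgroup F b h Fe α).map (𝒢.piVToPi v F)
  have hua' : ub • a = a := by change 𝒢.piVToPi v F u • a = a; rw [piVToPi_smul]; exact hua
  -- an open normal `N ≤ Stab(a₀)` with `u ∉ D_b · N`
  have hU : IsOpen ((MulAction.stabilizer (𝒢.Pi v F) a : Set (𝒢.Pi v F)) ∩
      {n | ub * n⁻¹ ∈ (Db : Set (𝒢.Pi v F))ᶜ}) :=
    (stabilizer_isOpen (𝒢.Pi v F) a).inter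
      ((isClosed_map_piVToPi_branchSubgroup F b h Fe α).isOpen_compl.preimage
        (continuous_const.mul continuous_inv))
  obtain ⟨N, hN⟩ := ProfiniteGrp.exist_openNormalSubgroup_sub_open_nhds_of_one hU
    ⟨(MulAction.stabilizer (𝒢.Pi v F) a).one_mem, by
      change ub * 1⁻¹ ∈ (Db : Set (𝒢.Pi v F))ᶜ; rw [inv_one, mul_one]; exact huD⟩
  have hNstab : (N : Set (𝒢.Pi v F)) ⊆ MulAction.stabilizer (𝒢.Pi v F) a := fun n hn => (hN hn).1
  have hNDb : ub ∉ (Db : Set (𝒢.Pi v F)) * (N : Set (𝒢.Pi v F)) := by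
    rintro ⟨d, hd, n, hn, hdn⟩
    have h2 := (hN hn).2
    apply h2
    have : ub * n⁻¹ = d := by rw [← hdn]; group
    rw [this]; exact hd
  -- a Galois object with a point of stabiliser `N`, mapping to `A` with `y₀ ↦ a₀`
  obtain ⟨Y, hY, y₀, hy₀⟩ := exists_isGalois_stabilizer_eq (𝒢.ρ v ⋙ F) N.toOpenSubgroup
  haveI := hY
  obtain ⟨g, hg⟩ := exists_hom_of_stabilizer_le (𝒢.ρ v ⋙ F) y₀ a (by
    rw [hy₀]; exact fun n hn => hNstab hn)
  -- the level edges of `y₀` and of `u · y₀`, and their common end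
  obtain ⟨c, hc⟩ := exists_eComp_mem Y F b h Fe α y₀
  obtain ⟨c', hc'⟩ := exists_eComp_mem Y F b h Fe α (ub • y₀)
  obtain ⟨p, hp⟩ := exists_vComp_mem Y F y₀
  have hp' : (show F.obj (Y.S v) from ub • y₀) ∈ Set.range (F.map p.1.arrow) := by
    rw [range_map_arrow_eq_orbit F p hp]
    exact ⟨u, (piVToPi_smul Y F u y₀).symm⟩
  have hco : Y.componentOver b v h c = p := componentOver_eq_of_mem Y F b h Fe α hc hp
  have hco' : Y.componentOver b v h c' = p := componentOver_eq_of_mem Y F b h Fe α hc' hp'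
  have hcc' : c' ≠ c := by
    intro hcc
    exact hNDb (by
      have := (eComp_eq_iff_mem_map_mul_stabilizer Y F b h Fe α ub hc hc').mp hcc
      rwa [hy₀] at this)
  -- both level edges lie over `Q`
  have hover : ∀ (x : F.obj (Y.S v)) (cx : π₀Obj (Y.T (𝒢.graph.edgeOf b))),
      Fe.map (Y.ψ b v h).hom (α.inv.app (Y.S v) x) ∈ Set.range (Fe.map cx.1.arrow) →
      F.map (g.fS v) x = a₀ → componentUnder (g.fT (𝒢.graph.edgeOf b)) cx = Q := by
    intro x cx hx hgx
    obtain ⟨q, hq⟩ := hx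
    obtain ⟨k, hk⟩ := exists_factor_componentUnder (g.fT (𝒢.graph.edgeOf b)) cx
    refine component_eq_of_mem_range Fe _ Q (x := Fe.map (g.fT (𝒢.graph.edgeOf b))
      (Fe.map (Y.ψ b v h).hom (α.inv.app (Y.S v) x))) ⟨Fe.map k q, ?_⟩ ?_
    · rw [← hq, ← FintypeCat.comp_apply, ← FintypeCat.comp_apply, ← Fe.map_comp, ← Fe.map_comp, hk]
    · have hcomm := g.comm b v h
      rw [← FintypeCat.comp_apply, ← Fe.map_comp, ← hcomm, Fe.map_comp, FintypeCat.comp_apply]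
      change Fe.map (A.ψ b v h).hom ((α.inv.app (Y.S v) ≫ ((𝒢.pull b v h).pullback ⋙ Fe).map (g.fS v)) x) ∈ _
      rw [← α.inv.naturality (g.fS v)]
      change Fe.map (A.ψ b v h).hom (α.inv.app (A.S v) (F.map (g.fS v) x)) ∈ _
      rw [hgx]; exact ha₀
  have hcQ : componentUnder (g.fT (𝒢.graph.edgeOf b)) c = Q := hover y₀ c hc hg
  have hcQ' : componentUnder (g.fT (𝒢.graph.edgeOf b)) c' = Q := hover _ c' hc' (by
    change (𝒢.ρ v ⋙ F).map g (ub • y₀) = a₀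
    rw [← mulAction_naturality, show (𝒢.ρ v ⋙ F).map g y₀ = a from hg]; exact hua')
  -- the two branch-cells
  have hab : ∀ cx : π₀Obj (Y.T (𝒢.graph.edgeOf b)), Y.componentOver b v h cx = p →
      Y.fibreData.total.abuts ⟨b, equivShrink _ cx⟩ = some ⟨v, equivShrink _ p⟩ := fun cx hcx => by
    have := coveringGraph_abuts_mk Y b h cx
    change Y.fibreData.total.abuts _ = _ at this
    rw [this, hcx]
  refine ⟨Y, hY, g, ⟨b, equivShrink _ c⟩, ⟨b, equivShrink _ c'⟩, rfl, fun heq => hcc' ?_, ?_, ?_, ?_⟩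
  · exact (equivShrink _).injective (eq_of_heq (Sigma.mk.inj_iff.mp heq).2)
  · rw [hab c hco]; rfl
  · rw [hab c hco, hab c' hco']
  · intro γ hγ
    simp only [List.mem_cons, List.mem_nil_iff, or_false] at hγ
    rcases hγ with rfl | rfl
    · exact Sigma.ext rfl (heq_of_eq (by
        change componentUnder (g.fT (𝒢.graph.edgeOf b)) ((equivShrink _).symm (equivShrink _ c)) = Q
        rw [Equiv.symm_apply_apply, hcQ]))
    · exact Sigma.ext rfl (heq_of_eq (by
        change componentUnder (g.fT (𝒢.graph.edgeOf b)) ((equivShrink _).symm (equivShrink _ c')) = Q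
        rw [Equiv.symm_apply_apply, hcQ']))

end Literature.AnabelianGeometry.SemiGraphs.SemiGraphOfAnabelioids.BObj
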